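import Literature.AlgebraicGeometry.Resolution.BlowupSequencesPruneMarked
import Literature.AlgebraicGeometry.Resolution.KollarTripleSequence
import Literature.AlgebraicGeometry.Resolution.HypersurfacePushforward
import Literature.AlgebraicGeometry.Resolution.MarkedIdealsEtale
import HarnessLib

/-!
# Multiple blow-ups along extensions and prunings; birational transforms of divisors along prunings and push-forwards (BGMW Def. 3.1.5, Kollár 3.32 / 3.34.1 / 3.30.3)

Topic: `Literature/AlgebraicGeometry/Resolution`. Complements to the extension / pruning
calculus of blow-up sequences (`CentreSeq.IsExtensionOf`, `CentreSeq.prune`,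
`BlowupSequencesExtensions.lean`, `BlowupSequencesPrune(Marked).lean`), needed to pass the
properties of Kollár's raw sequence `𝓑𝓓_{n,m,j}(X, I, E)` (Lemma 3.102, whose first blow-up
`π_{-1}` may be empty) to its pruning (Kollár's convention 3.32: "steps … are then ignored without
explicit mention whenever they happen to lead to empty blow-ups") and to iterate 3.102 along the
boundary (3.104 Step 2.1):

* `hasSNCWith_congr_removeEmpty`, `CentreSeq.isAdmissibleFor_congr_removeEmpty`,
  `CentreSeq.isResolutionOf_congr_removeEmpty` — simple normal crossings with, admissibility
  for and resolutions of `(X, I, E, μ)` see the ordered boundary `E` only through its non-empty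
  members (an empty divisor passes through no point);
* **`CentreSeq.IsExtensionOf.isAdmissibleFor`** — if `s` (an extension of `t`: `t` with empty
  blow-ups interspersed, BGMW Def. 3.1.5) is a multiple blow-up of `M`, so is `t` (an empty
  blow-up transforms `M` into its pull-back with one more, empty, boundary member,
  `MarkedIdeal.transform_of_eq_top`, and the later blow-ups are compared after pulling back
  along the isomorphism `B_∅ X → X`, `IsAdmissibleFor.comap_of_etale`); in particular
  **`CentreSeq.IsAdmissibleFor.prune`**;
* `CentreSeq.transformDivisor_mono`, `transformDivisor_congr`, `transformDivisor_comap` (flat base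
  change), **`transformDivisor_prune`** (`(s.prune)_*^{-1} D = pruneι^* (s_*^{-1} D)`, exactly),
  `support_transformMarked_prune` (`supp` of the final transform along `s.prune` is the preimage
  under `pruneι` of that along `s`), **`CentreSeq.IsResolutionOf.prune`**;
* `CentreSeq.prune_pushforward_of_isEmpty` — the push-forward of any sequence on the EMPTY
  scheme has only empty blow-ups: its pruning is the empty sequence.

## Sources

* E. Bierstone, D. Grigoriev, P. Milman, J. Włodarczyk, arXiv:1206.3090, Def. 3.1.3–3.1.5.
  [BierstoneGrigorievMilmanWlodarczyk2011]
* J. Kollár, *Lectures on Resolution of Singularities* (2007): 3.30.3 (p. 129), 3.32 (p. 130),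
  3.34.1 (p. 131), Lemma 3.102 (pp. 169–170). [Kollar2007]
-/

noncomputable section

open CategoryTheory CategoryTheory.Limits AlgebraicGeometry TopologicalSpace IsLocalRing

namespace Literature.AlgebraicGeometry.Resolution

universe u

open Kollar2007 (removeEmpty removeEmpty_append mem_removeEmpty_iff removeEmpty_map_of_map_top)

/-! ## Boundaries with the same non-empty members -/

section RemoveEmpty

variable {X : Scheme.{u}}

/-- Two ordered boundaries with the same non-empty members have the same members through every
point. [folklore] -/
theorem mem_iff_of_removeEmpty_eq {E₁ E₂ : List X.IdealSheafData} (h : removeEmpty E₁ = removeEmpty E₂)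
    {D : X.IdealSheafData} {x : X} (hx : x ∈ D.support) : D ∈ E₁ ↔ D ∈ E₂ := by
  have hD : D ≠ ⊤ := by
    rintro rfl
    rw [Scheme.IdealSheafData.support_top] at hx
    exact hx
  have h1 : D ∈ E₁ ↔ D ∈ removeEmpty E₁ := by rw [mem_removeEmpty_iff]; exact ⟨fun h => ⟨h, hD⟩, fun h => h.1⟩
  have h2 : D ∈ E₂ ↔ D ∈ removeEmpty E₂ := by rw [mem_removeEmpty_iff]; exact ⟨fun h => ⟨h, hD⟩, fun h => h.1⟩
  rw [h1, h2, h]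

/-- **Simple normal crossings (with a centre) see the boundary only through its non-empty
members** (an empty divisor passes through no point). [cite: BierstoneGrigorievMilmanWlodarczyk2011, Def. 3.1.1] -/
theorem hasSNCWith_of_removeEmpty_eq {E₁ E₂ : List X.IdealSheafData} (h : removeEmpty E₁ = removeEmpty E₂)
    {C : X.IdealSheafData} (h₁ : HasSNCWith E₁ C) : HasSNCWith E₂ C := by
  intro x
  obtain ⟨hreg, u, hu, ⟨ι, hι, hιD⟩, hC⟩ := h₁ x
  refine ⟨hreg, u, hu, ⟨fun D => ι ⟨D.1, (mem_iff_of_removeEmpty_eq h D.2.2).mpr D.2.1, D.2.2⟩, ?_, ?_⟩, hC⟩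
  · intro D D' hDD'
    have := hι hDD'
    exact Subtype.ext (congrArg (fun D : {D // D ∈ E₁ ∧ x ∈ D.support} => D.1) this)
  · intro D
    exact hιD ⟨D.1, (mem_iff_of_removeEmpty_eq h D.2.2).mpr D.2.1, D.2.2⟩

/-- `HasSNCWith` for boundaries with the same non-empty members. [folklore] -/
theorem hasSNCWith_congr_removeEmpty {E₁ E₂ : List X.IdealSheafData} (h : removeEmpty E₁ = removeEmpty E₂)
    (C : X.IdealSheafData) : HasSNCWith E₁ C ↔ HasSNCWith E₂ C :=
  ⟨hasSNCWith_of_removeEmpty_eq h, hasSNCWith_of_removeEmpty_eq h.symm⟩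

/-- The transformed boundaries of boundaries with the same non-empty members have the same
non-empty members (the strict transform of the empty divisor is empty). [cite: Kollar2007, 3.32 (p. 130)] -/
theorem removeEmpty_transform_boundary_eq {X' : Scheme.{u}} (π : X' ⟶ X) (C : X.IdealSheafData)
    {I : X.IdealSheafData} {E₁ E₂ : List X.IdealSheafData} {μ : ℕ}
    (h : removeEmpty E₁ = removeEmpty E₂) :
    removeEmpty ((⟨I, E₁, μ⟩ : MarkedIdeal X).transform π C).boundary =
      removeEmpty ((⟨I, E₂, μ⟩ : MarkedIdeal X).transform π C).boundary := by
  simp only [MarkedIdeal.transform_boundary, removeEmpty_append]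
  rw [removeEmpty_map_of_map_top _ (strictTransformIdeal_top _ _) E₁,
    removeEmpty_map_of_map_top _ (strictTransformIdeal_top _ _) E₂, h]

/-- **Admissibility for `(X, I, E, μ)` sees `E` only through its non-empty members.**
[cite: BierstoneGrigorievMilmanWlodarczyk2011, Def. 3.1.3; Kollar2007, 3.32 (p. 130)] -/
theorem CentreSeq.isAdmissibleFor_congr_removeEmpty : ∀ {X : Scheme.{u}} (s : CentreSeq X)
    {I : X.IdealSheafData} {E₁ E₂ : List X.IdealSheafData} {μ : ℕ},
    removeEmpty E₁ = removeEmpty E₂ →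
      (s.IsAdmissibleFor ⟨I, E₁, μ⟩ ↔ s.IsAdmissibleFor ⟨I, E₂, μ⟩)
  | _, .nil _, _, _, _, _, _ => Iff.rfl
  | X, .cons C rest, I, E₁, E₂, μ, h => by
    change (_ ∧ HasSNCWith E₁ C ∧ _ ∧ rest.IsAdmissibleFor ((⟨I, E₁, μ⟩ : MarkedIdeal X).transform (blowup.π C) C)) ↔
      (_ ∧ HasSNCWith E₂ C ∧ _ ∧ rest.IsAdmissibleFor ((⟨I, E₂, μ⟩ : MarkedIdeal X).transform (blowup.π C) C))
    rw [hasSNCWith_congr_removeEmpty h C]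
    have e₁ : ((⟨I, E₁, μ⟩ : MarkedIdeal X).transform (blowup.π C) C) =
        ⟨controlledTransform (blowup.π C) C I μ, ((⟨I, E₁, μ⟩ : MarkedIdeal X).transform (blowup.π C) C).boundary, μ⟩ := rfl
    have e₂ : ((⟨I, E₂, μ⟩ : MarkedIdeal X).transform (blowup.π C) C) =
        ⟨controlledTransform (blowup.π C) C I μ, ((⟨I, E₂, μ⟩ : MarkedIdeal X).transform (blowup.π C) C).boundary, μ⟩ := rfl
    rw [e₁, e₂, CentreSeq.isAdmissibleFor_congr_removeEmpty rest (removeEmpty_transform_boundary_eq (blowup.π C) C h)]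
    exact Iff.rfl

/-- **Resolutions of `(X, I, E, μ)` see `E` only through its non-empty members.**
[cite: BierstoneGrigorievMilmanWlodarczyk2011, Def. 3.1.3; Kollar2007, 3.32 (p. 130)] -/
theorem CentreSeq.isResolutionOf_congr_removeEmpty {X : Scheme.{u}} (s : CentreSeq X)
    {I : X.IdealSheafData} {E₁ E₂ : List X.IdealSheafData} {μ : ℕ}
    (h : removeEmpty E₁ = removeEmpty E₂) :
    s.IsResolutionOf ⟨I, E₁, μ⟩ ↔ s.IsResolutionOf ⟨I, E₂, μ⟩ := by
  unfold CentreSeq.IsResolutionOf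
  rw [s.isAdmissibleFor_congr_removeEmpty h]
  obtain ⟨h₁, h₂, -⟩ := s.transformMarked_congr_removeEmpty (M₁ := ⟨I, E₁, μ⟩) (M₂ := ⟨I, E₂, μ⟩) rfl rfl h
  have hs : (s.transformMarked ⟨I, E₁, μ⟩).support = (s.transformMarked ⟨I, E₂, μ⟩).support := by
    unfold MarkedIdeal.support
    rw [h₁, h₂]
  rw [hs]

end RemoveEmpty

/-! ## Multiple blow-ups along extensions -/

namespace CentreSeq

variable {X : Scheme.{u}}

/-- One more empty boundary member does not change the non-empty members. [folklore] -/
theorem removeEmpty_append_top (E : List X.IdealSheafData) : removeEmpty (E ++ [⊤]) = removeEmpty E := by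
  rw [removeEmpty_append, Kollar2007.removeEmpty_cons_top, Kollar2007.removeEmpty_nil, List.append_nil]

/-- **A multiple blow-up along an extension is a multiple blow-up along the extended sequence**:
if `s` is an extension of `t` (BGMW Def. 3.1.5) and `s` is admissible for `M`, then so is `t`.
A matched step is compared directly; an empty blow-up `B_∅ X → X` transforms `M` into its
pull-back with one more, empty, boundary member (`MarkedIdeal.transform_of_eq_top`), the rest of
`s` is admissible for it and is an extension of `π^* t`, whence (induction) `π^* t` is admissible
for it, and pulling back along the inverse isomorphism (`IsAdmissibleFor.comap_of_etale`) `t` is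
admissible for `M` with one more empty boundary member, i.e. for `M`
(`isAdmissibleFor_congr_removeEmpty`). [cite: BierstoneGrigorievMilmanWlodarczyk2011, Def. 3.1.5 with Def. 3.1.3; Kollar2007, 3.32 (p. 130)] -/
theorem IsExtensionOf.isAdmissibleFor : ∀ {X : Scheme.{u}} [IsLocallyNoetherian X] {s t : CentreSeq X},
    s.IsExtensionOf t → ∀ M : MarkedIdeal X, s.IsAdmissibleFor M → t.IsAdmissibleFor M
  | _, _, nil _, t, h, M, _ => by
    rw [nil_isExtensionOf_iff] at h
    subst h
    trivial
  | X, _, cons C rest, t, h, M, hadm => by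
    haveI : IsLocallyNoetherian (blowup C) := isLocallyNoetherian_blowup C
    rcases h with ⟨rest', rfl, hr⟩ | ⟨hC, hr⟩
    · exact ⟨hadm.1, hadm.2.1, hadm.2.2.1, hr.isAdmissibleFor _ hadm.2.2.2⟩
    · haveI := isIso_blowup_π_of_eq_top hC
      have h1 : (t.comap (blowup.π C)).IsAdmissibleFor (M.transform (blowup.π C) C) :=
        hr.isAdmissibleFor _ hadm.2.2.2
      have h2 := IsAdmissibleFor.comap_of_etale (t.comap (blowup.π C)) (inv (blowup.π C))
        (M.transform (blowup.π C) C) h1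
      rw [comap_comap_of_comp_eq_id (IsIso.inv_hom_id (blowup.π C)) t,
        MarkedIdeal.transform_of_eq_top _ hC] at h2
      have hb : ((M.comap (blowup.π C)).boundary ++ [⊤]).map (fun D : (blowup C).IdealSheafData => D.comap (inv (blowup.π C))) =
          M.boundary ++ [⊤] := by
        rw [MarkedIdeal.comap_boundary, List.map_append, List.map_map, List.map_singleton,
          Scheme.IdealSheafData.comap_top]
        congr 1
        conv_rhs => rw [← List.map_id M.boundary]
        refine List.map_congr_left fun (D : X.IdealSheafData) _ => ?_
        simp only [Function.comp_apply, ← Scheme.IdealSheafData.comap_comp, IsIso.inv_hom_id,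
          Scheme.IdealSheafData.comap_id, id_eq]
      have hi : ((M.comap (blowup.π C)).ideal).comap (inv (blowup.π C)) = M.ideal := by
        rw [MarkedIdeal.comap_ideal, ← Scheme.IdealSheafData.comap_comp, IsIso.inv_hom_id,
          Scheme.IdealSheafData.comap_id]
      change t.IsAdmissibleFor ⟨((M.comap (blowup.π C)).ideal).comap (inv (blowup.π C)),
        ((M.comap (blowup.π C)).boundary ++ [⊤]).map (fun D : (blowup C).IdealSheafData => D.comap (inv (blowup.π C))), M.mult⟩ at h2
      rw [hb, hi] at h2
      exact (t.isAdmissibleFor_congr_removeEmpty (I := M.ideal) (μ := M.mult)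
        (removeEmpty_append_top M.boundary)).mp h2

/-- **A multiple blow-up stays one after deleting its empty blow-ups** (Kollár's convention
3.32). [cite: Kollar2007, 3.32 (p. 130), 3.34.1 (p. 131)] -/
theorem IsAdmissibleFor.prune [IsLocallyNoetherian X] {s : CentreSeq X} {M : MarkedIdeal X}
    (h : s.IsAdmissibleFor M) : s.prune.IsAdmissibleFor M :=
  (isExtensionOf_prune s).isAdmissibleFor M h

/-! ## Birational transforms of divisors along base changes, casts and prunings -/

/-- The iterated birational transform is monotone in the divisor ideal. [folklore] -/
theorem transformDivisor_mono : ∀ {X : Scheme.{u}} (s : CentreSeq X) {D D' : X.IdealSheafData},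
    D ≤ D' → s.transformDivisor D ≤ s.transformDivisor D'
  | _, nil _, _, _, h => h
  | _, cons C rest, _, _, h => by
    rw [transformDivisor_cons, transformDivisor_cons]
    refine transformDivisor_mono rest ?_
    rw [strictTransformIdeal, strictTransformIdeal]
    exact iSup_mono fun n => colon_mono_left (Scheme.IdealSheafData.comap_mono (blowup.π C) h) _

/-- Transport of the iterated birational transform along an equality of sequences. [folklore] -/
theorem transformDivisor_congr {s₁ s₂ : CentreSeq X} (e : s₁ = s₂) (D : X.IdealSheafData) :
    s₁.transformDivisor D = (s₂.transformDivisor D).comap (eqToHom (congrArg top e)) := by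
  subst e
  simp

/-- **Iterated birational transforms commute with flat base change**: along the induced
sequence `f^*s`, `(f^*s)_*^{-1}(f^*D) = (comapι)^* (s_*^{-1} D)` (from `transformMarked_comap` for
the marked ideal `(X, ⊤, [D], 0)`). [cite: BierstoneGrigorievMilmanWlodarczyk2011, Thm. 8.0.5 (2)] -/
theorem transformDivisor_comap {U : Scheme.{u}} [IsLocallyNoetherian X] [IsLocallyNoetherian U]
    (s : CentreSeq X) (f : U ⟶ X) [Flat f] (D : X.IdealSheafData) :
    (s.comap f).transformDivisor (D.comap f) = (s.transformDivisor D).comap (s.comapι f) := by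
  have h := congrArg MarkedIdeal.boundary (transformMarked_comap s f ⟨⊤, [D], 0⟩)
  rw [transformMarked_boundary, MarkedIdeal.comap_boundary, MarkedIdeal.comap_boundary,
    transformMarked_boundary] at h
  simp only [List.map_cons, List.map_nil, List.cons_append, List.nil_append,
    List.cons.injEq] at h
  exact h.1

/-- **The birational transform of a divisor along the pruned sequence is the pull-back along
`pruneι` of its birational transform along the sequence**, exactly (an empty blow-up transforms
`D` into its pull-back, `strictTransformIdeal_of_eq_top`, and the rest is moved along
isomorphisms, `transformDivisor_comap`). [cite: Kollar2007, 3.34.1 (p. 131) with 3.32 (p. 130)] -/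
theorem transformDivisor_prune : ∀ {X : Scheme.{u}} [IsLocallyNoetherian X] (s : CentreSeq X)
    (D : X.IdealSheafData), s.prune.transformDivisor D = (s.transformDivisor D).comap s.pruneι
  | X, _, nil _, D => by
    show D = D.comap (𝟙 X)
    rw [Scheme.IdealSheafData.comap_id]
  | X, _, cons C rest, D => by
    haveI : IsLocallyNoetherian (blowup C) := isLocallyNoetherian_blowup C
    by_cases hC : C = ⊤
    · haveI := isIso_blowup_π_of_eq_top hC
      have e := prune_cons_of_eq_top hC rest
      have ih := transformDivisor_prune rest (strictTransformIdeal (blowup.π C) C D)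
      set P := rest.prune with hPdef
      set ι := inv (blowup.π C) with hιdef
      have hD : D = (strictTransformIdeal (blowup.π C) C D).comap ι := by
        rw [strictTransformIdeal_of_eq_top _ hC, ← Scheme.IdealSheafData.comap_comp, hιdef,
          IsIso.inv_hom_id, Scheme.IdealSheafData.comap_id]
      have hι : (cons C rest).pruneι = eqToHom (congrArg top e) ≫ P.comapι ι ≫ rest.pruneι :=
        pruneι_cons_of_eq_top hC rest
      rw [transformDivisor_congr e, hι, transformDivisor_cons]
      dsimp only [top_cons]
      conv_lhs => rw [hD]
      rw [transformDivisor_comap P ι, ih, ← Scheme.IdealSheafData.comap_comp,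
        ← Scheme.IdealSheafData.comap_comp, Category.assoc]
    · have e := prune_cons_of_ne_top hC rest
      have ih := transformDivisor_prune rest (strictTransformIdeal (blowup.π C) C D)
      have hι : (cons C rest).pruneι = eqToHom (congrArg top e) ≫ rest.pruneι :=
        pruneι_cons_of_ne_top hC rest
      rw [transformDivisor_congr e, hι, transformDivisor_cons, transformDivisor_cons]
      dsimp only [top_cons]
      rw [ih, ← Scheme.IdealSheafData.comap_comp]

/-- **The support of the final transform along the pruned sequence is the preimage under
`pruneι` of the support of the final transform** (the ideal is the pull-back and the marking the
same, `transformMarked_prune`; `pruneι` is an isomorphism). [cite: Kollar2007, 3.34.1 (p. 131)] -/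
theorem support_transformMarked_prune [IsLocallyNoetherian X] (s : CentreSeq X) (M : MarkedIdeal X) :
    (s.prune.transformMarked M).support = s.pruneι ⁻¹' (s.transformMarked M).support := by
  obtain ⟨h₁, h₂, -⟩ := transformMarked_prune s M
  haveI : IsLocallyNoetherian s.top := by
    haveI : IsProper s.comp := s.isProper_comp
    exact LocallyOfFiniteType.isLocallyNoetherian s.comp
  haveI : IsLocallyNoetherian s.prune.top := by
    haveI : IsProper s.prune.comp := s.prune.isProper_comp
    exact LocallyOfFiniteType.isLocallyNoetherian s.prune.comp
  have key : s.prune.transformMarked M =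
      ⟨(s.transformMarked M).ideal.comap s.pruneι, (s.prune.transformMarked M).boundary,
        (s.transformMarked M).mult⟩ := by
    rw [← h₁, ← h₂]
  rw [key]
  exact MarkedIdeal.support_comap_of_etale s.pruneι (s.transformMarked M) _

/-- **A resolution stays one after deleting its empty blow-ups** (Kollár's convention 3.32).
[cite: Kollar2007, 3.32 (p. 130), 3.34.1 (p. 131)] -/
theorem IsResolutionOf.prune [IsLocallyNoetherian X] {s : CentreSeq X} {M : MarkedIdeal X}
    (h : s.IsResolutionOf M) : s.prune.IsResolutionOf M := by
  refine ⟨h.1.prune, ?_⟩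
  rw [support_transformMarked_prune, h.2, Set.preimage_empty]

/-! ## Push-forwards from the empty scheme -/

/-- An ideal sheaf on the empty scheme is the unit ideal sheaf. [folklore] -/
theorem _root_.Literature.AlgebraicGeometry.Resolution.idealSheafData_eq_top_of_isEmpty {S : Scheme.{u}}
    [IsEmpty S] (C : S.IdealSheafData) : C = ⊤ := by
  rw [← Scheme.IdealSheafData.support_eq_bot_iff]
  ext x
  exact (IsEmpty.false x).elim

/-- **The push-forward of a blow-up sequence on the empty scheme has only empty blow-ups: its
pruning is the empty sequence.** [cite: Kollar2007, 3.32 (p. 130), 3.30.3 (p. 129)] -/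
theorem prune_pushforward_of_isEmpty : ∀ {S X : Scheme.{u}} [IsEmpty S] (t : CentreSeq S) (τ : S ⟶ X)
    [IsClosedImmersion τ], (t.pushforward τ).prune = nil X
  | _, _, _, nil _, _, _ => rfl
  | S, X, _, cons C' rest, τ, _ => by
    have hC' : C' = ⊤ := idealSheafData_eq_top_of_isEmpty C'
    have htop : C'.map τ = ⊤ := (map_eq_top_iff_of_isClosedImmersion τ C').mpr hC'
    haveI : IsEmpty (blowup C') := ⟨fun y => IsEmpty.false ((blowup.π C').base y)⟩
    rw [pushforward_cons, prune_cons_of_eq_top htop, prune_pushforward_of_isEmpty rest]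
    rfl

end CentreSeq

end Literature.AlgebraicGeometry.Resolution

end
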